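import Literature.NumberTheory.Sieve.FriedlanderIwaniecPrimesMainTermSplit
import Literature.NumberTheory.Sieve.FriedlanderIwaniecPrimesLemma171
import Mathlib.NumberTheory.ArithmeticFunction.Moebius
import HarnessLib

/-!
# Friedlander–Iwaniec, *The polynomial `X² + Y⁴` captures its primes*, §17: the transformations of `W(β)` — (17.1), the insertion of Lemma 17.1 ((17.5), (17.8)) and the rational-class form (17.9)

Family `parity`, statement parity.S17 (`setOf_prime_sq_add_pow_four_infinite`); Line A of the FI
`a² + b⁴` completion, ROUND-8 §8 node (vi) (Proposition 17.3, the bound for `W(β)`). Source: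
J. Friedlander, H. Iwaniec, Ann. of Math. (2) 148 (1998), 945–1040 = arXiv:math/9811185
[FriedlanderIwaniecAnnals1998], §17 "Transformations of `W(β)`", arXiv pp. 66–67: the display before
(17.1), (17.1), Lemma 17.1 (17.5), (17.8), (17.9). Everything here is PROVED (no named facts).

"It remains to estimate the partial sum `W(β)` of `T(β)` over `d > |Δ|/4X`. In addition to this lower
bound, `4d` divides the determinant `Δ` and, since `d` is extremely large it is useful to switch `d`
into the complementary divisor of `|Δ|/4`. We get (see (10.13) and (10.17))
`W(β) = 2 Σ_d f*(4d) ΣΣ_{(z₁,z₂)=1, Δ(z₁,z₂) ≡ 0 (4d)} β_{z₁} β̄_{z₂} ((z₂/z₁)/(|Δ|d)) (4d/|Δ|) φ(|Δ|/4d) log 2|z₁z₂/Δ|`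
because `((z₂/z₁)/(|Δ|/4d)) = ((z₂/z₁)/(|Δ|d))`. Here we write `(4d/|Δ|)φ(|Δ|/4d) = Σ_{4bd∣Δ} μ(b)/b`
so that `W(β)` becomes (17.1) … Inserting (17.5) in (17.1) we arrive at
`W(β) = 2 Σ_b μ(b)/b Σ_d f*(4d) ΣΣ_{(z₁,z₂)=1, Δ ≡ 0 (4bd)} β'_{z₁} β̄'_{z₂} ((z₂/z₁)/d) log 2|z₁z₂/Δ|`
where (17.8) `β'_z = i^{(r-1)/2} (s/|r|) β_z` if `z = r + is`. … Since the condition `Δ(z₁,z₂) ≡ 0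
(mod 4bd)` is equivalent to `z₁ ≡ ω z₂ (mod 4bd)` for some rational `ω (mod 4bd)` we have (17.9)".

This file proves these transformations for the tree's `W(β) = fiW X S b` of (10.17)
(`…MainTermSplit`: `fiTwisted (fiCutW X)`, kernel `fiTKernel d = φ(d)/d · fiChi d · log(2|z₁z₂|/|Δ|)`,
moduli `fiModuli` = `{d : 4d ∣ Δ}`), with real weights `b` (so `β̄ = β`) and the real form
`β'_z = (s/|r|) β_z` of (17.8) (the units `i^{(r-1)/2}` cancel in pairs since `r₁ ≡ r₂ (mod 8)`; the
complex `[z] = i^{(r-1)/2}(s/|r|)` = `jacobiKubota` enters only at (17.14), `…SpinCharSumsZForm`):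

* `mem_fiModuli_iff`, **`sum_fiModuli_flip`** — the flip `d ↦ |Δ|/4d` is an involution of the moduli;
  `totient_div_eq_sum_moebius_div` — `φ(m)/m = Σ_{b∣m} μ(b)/b`;
* `jacobiSym_ratioClass_natAbs_ordCompl` — Lemma 17.1 ((17.5)) for the rational class
  `A ≡ z₂/z₁ (mod Δ)` (from the tree's `jacobiSym_norm_mul_re_star_mul_of_isCoprime`, stated at the
  representative `|z₁|² Re(z̄₁z₂) ≡ A v⁻²`);
  **`fiChi_natAbs_div`** — the symbol after the flip: for `4ce ∣ Δ`,
  `χ_{|Δ|/4e}(z₂/z₁) = (s₁/|r₁|)(s₂/|r₂|) · (ω/e')` with `ω = ratioClass (4ce) z₁ z₂` the rational class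
  of (16.3) ("`((z₂/z₁)/(|Δ|/4d)) = ((z₂/z₁)/(|Δ|d))`", then (17.5); the class of `z₁/z₂` and the printed
  inverse class `z₂/z₁` give the same real-character value);
  `fiDelta_ne_zero_of_isCoprime` — `Δ ≠ 0` for admissible pairs ("`1 ≤ |Δ|`");
* `sum_fiModuli_cutW_kernel_eq` — the inner sum of `W(β)` for one admissible pair, rewritten over
  the moduli `4ce ∣ Δ` in fixed ranges `c, e ≤ D` (`|Δ| ≤ 4D`);
* **`fiW_eq_sum_moebius_flip`** — (17.1) + (17.5)/(17.8) + (17.9):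
  `W(β) = 2 Σ_{c ≤ D} Σ_{e ≤ D} μ(c)/c f*(4e) ΣΣ_{(z₁,z₂)=1} [4ce ∣ Δ] (ω_{4ce}(z₁,z₂)/e') β'_{z₁} β'_{z₂} log(2|z₁z₂|/|Δ|)`,
  the shape consumed by the detection identity `sum_sum_dvd_im_eq_sum_mulChar` ((17.10),
  `…CharacterDetection`) once `(z₁,z₂) = 1` is removed and the logarithm is mollified ((16.5)–(16.9)).

Hypotheses (as in (17.2)–(17.4) and §5): on `S`, real parts odd, congruent mod `8`, of one sign
(`z ≡ z₀ (mod 8)` primary, one narrow sector (5.12)), `(z, z̄) = 1` (odd squarefree norms);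
`Δ ≠ 0` on coprime pairs (`fiDelta_ne_zero_of_isCoprime`); `|Δ| ≤ 4D` (any `D ≥ N/2` in the box
(5.14)). What remains for Proposition 17.3 after this file is §16-type analysis shared with node (v):
the tail `b > X`, the removal of `(z₁,z₂) = 1`, the log-mollifier (16.5)–(16.9), (17.10)–(17.13), and
Proposition 17.2 (`FriedlanderIwaniec1998_prop172_zForm`, kernel).

## References

* J. Friedlander, H. Iwaniec, Ann. of Math. (2) 148 (1998), 945–1040, §17 (17.1)–(17.9); §10
  (10.13), (10.17); §8 (8.15); §16 (16.3). [FriedlanderIwaniecAnnals1998]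

## Mathlib / tree search

Tree: `fiW`, `fiTwisted`, `fiCutW`, `fiTenFstar`, `fiTKernel`, `fiChi`, `fiModuli`, `fiDelta`,
`fiAbsProd` (`…MainTermSplit`); `ratioClass`, `normInv`, `dvd_normInv_mul_norm_sub_one`,
`dvd_sub_ratioClass_mul_of_dvd_im`, `dvd_sub_ratioClass_of_dvd_sub`, `isCoprime_ratioClass`,
`im_star_mul` (`…CharacterDetection`); `jacobiSym_norm_mul_re_star_mul_of_isCoprime`,
`isCoprime_norm_im_star_mul` (`…Lemma171`); `gaussCoprime_iff` (`…CoprimeCount`). Mathlib: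
`ArithmeticFunction.sum_eq_iff_sum_mul_moebius_eq`, `Nat.sum_totient`, `Nat.sum_divisorsAntidiagonal`,
`jacobiSym.mod_left'`, `jacobiSym.mul_left`, `jacobiSym.mul_right'`, `jacobiSym.sq_one`,
`jacobiSym.pow_left`, `Nat.ordCompl_mul`, `Nat.ordCompl_self_pow`, `Nat.dvd_div_iff_mul_dvd`,
`Finset.sum_nbij'`, `Finset.sum_comm`, `Zsqrtd.norm_eq_mul_conj`, `Zsqrtd.intCast_dvd_intCast`,
`IsCoprime.isUnit_of_dvd'`.
-/

noncomputable section

open Finset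
open scoped NumberTheorySymbols Nat ArithmeticFunction.Moebius

namespace Literature.NumberTheory.Sieve.FriedlanderIwaniecPrimes

/-! ### The moduli `4d ∣ Δ` and the flip `d ↦ |Δ|/4d` -/

/-- `d ∈ fiModuli z₁ z₂ ↔ Δ ≠ 0 ∧ 4d ∣ |Δ|`. [cite: FriedlanderIwaniecAnnals1998, (8.16), (10.13)] -/
theorem mem_fiModuli_iff {z₁ z₂ : GaussianInt} {d : ℕ} :
    d ∈ fiModuli z₁ z₂ ↔ (fiDelta z₁ z₂).natAbs ≠ 0 ∧ 4 * d ∣ (fiDelta z₁ z₂).natAbs := by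
  rw [fiModuli, mem_filter, Nat.mem_divisors]
  have h4 : (4 * (d : ℤ)) ∣ fiDelta z₁ z₂ ↔ 4 * d ∣ (fiDelta z₁ z₂).natAbs := by
    rw [← Int.natCast_dvd]; push_cast; exact Iff.rfl
  rw [h4]
  constructor
  · rintro ⟨⟨-, hn⟩, h⟩; exact ⟨hn, h⟩
  · rintro ⟨hn, h⟩; exact ⟨⟨(dvd_mul_left d 4).trans h, hn⟩, h⟩

/-- **The flip `d ↦ |Δ|/4d`** on the moduli `4d ∣ Δ` ("since `d` is extremely large it is useful to
switch `d` into the complementary divisor of `|Δ|/4`", §17 before (17.1)): an involution of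
`fiModuli z₁ z₂`, so `Σ_{4d∣Δ} G(d) = Σ_{4d∣Δ} G(|Δ|/4d)`. [cite: FriedlanderIwaniecAnnals1998, §17 before (17.1)] -/
theorem sum_fiModuli_flip {z₁ z₂ : GaussianInt} (G : ℕ → ℝ) :
    ∑ d ∈ fiModuli z₁ z₂, G d = ∑ d ∈ fiModuli z₁ z₂, G ((fiDelta z₁ z₂).natAbs / (4 * d)) := by
  set n := (fiDelta z₁ z₂).natAbs with hn
  -- the involution
  have hinv : ∀ d ∈ fiModuli z₁ z₂, n / (4 * d) ∈ fiModuli z₁ z₂ ∧ n / (4 * (n / (4 * d))) = d := by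
    intro d hd
    obtain ⟨hn0, ⟨e, he⟩⟩ := mem_fiModuli_iff.mp hd
    rw [← hn] at hn0 he
    have hd0 : 0 < d := Nat.pos_of_ne_zero fun h => hn0 (by rw [he, h]; ring)
    have he0 : 0 < e := Nat.pos_of_ne_zero fun h => hn0 (by rw [he, h]; ring)
    have h1 : n / (4 * d) = e := by rw [he, Nat.mul_div_cancel_left _ (by omega)]
    rw [h1]
    refine ⟨mem_fiModuli_iff.mpr ⟨hn0, ⟨d, by rw [← hn, he]; ring⟩⟩, ?_⟩
    rw [he, show 4 * d * e = 4 * e * d by ring, Nat.mul_div_cancel_left _ (by omega)]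
  exact sum_nbij' (fun d => n / (4 * d)) (fun d => n / (4 * d)) (fun d hd => (hinv d hd).1)
    (fun d hd => (hinv d hd).1) (fun d hd => (hinv d hd).2) (fun d hd => (hinv d hd).2)
    (fun d hd => by rw [(hinv d hd).2])

/-! ### `φ(m)/m = Σ_{b ∣ m} μ(b)/b` -/

/-- "Here we write `(4d/|Δ|) φ(|Δ|/4d) = Σ_{4bd∣Δ} μ(b)/b`": `φ(m)/m = Σ_{b ∣ m} μ(b)/b` (Möbius
inversion of `Σ_{d∣m} φ(d) = m`). [cite: FriedlanderIwaniecAnnals1998, §17 before (17.1)] -/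
theorem totient_div_eq_sum_moebius_div {m : ℕ} (hm : 0 < m) :
    ((m.totient : ℝ) / m) = ∑ b ∈ m.divisors, (μ b : ℝ) / b := by
  have key := (ArithmeticFunction.sum_eq_iff_sum_mul_moebius_eq (R := ℝ)
    (f := fun i => (i.totient : ℝ)) (g := fun n => (n : ℝ))).mp
    (fun n _ => by exact_mod_cast Nat.sum_totient n) m hm
  rw [Nat.sum_divisorsAntidiagonal (fun a b => (μ a : ℝ) * (b : ℝ))] at key
  have hm0 : (m : ℝ) ≠ 0 := by exact_mod_cast hm.ne'
  rw [← key, sum_div]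
  refine sum_congr rfl fun b hb => ?_
  have hbm : b ∣ m := Nat.dvd_of_mem_divisors hb
  have hb0 : (b : ℝ) ≠ 0 := by exact_mod_cast (Nat.pos_of_mem_divisors hb).ne'
  rw [Nat.cast_div hbm hb0]
  field_simp

/-! ### The symbol after the flip: Lemma 17.1 inserted -/

section Symbol

variable {z₁ z₂ : GaussianInt}

/-- `(Re z̄₁z₂, ·)`: `Re(z₂ z̄₁) = Re(z̄₁ z₂)`. [folklore] -/
private theorem re_mul_star_comm (z₁ z₂ : GaussianInt) : (z₂ * star z₁).re = (star z₁ * z₂).re := by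
  simp only [Zsqrtd.re_mul, Zsqrtd.re_star, Zsqrtd.im_star]; ring

/-- `Im(z̄₂ z₁) = -Δ(z₁, z₂)`. [folklore] -/
private theorem im_star_mul_swap (z₁ z₂ : GaussianInt) : (star z₂ * z₁).im = -(star z₁ * z₂).im := by
  rw [im_star_mul, im_star_mul]; ring

/-- `(N z₁, Δ) = 1` as a `Nat.Coprime` statement for a divisor `q ∣ |Δ|`. [folklore] -/
private theorem coprime_norm_of_dvd {q : ℕ} (h₁ : IsCoprime z₁ (star z₁)) (h₁₂ : IsCoprime z₁ z₂)
    (hq : q ∣ (fiDelta z₁ z₂).natAbs) : Nat.Coprime z₁.norm.natAbs q := by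
  have h := isCoprime_norm_im_star_mul h₁ h₁₂
  have h' : IsCoprime z₁.norm (q : ℤ) :=
    h.of_isCoprime_of_dvd_right (Int.natCast_dvd.mpr hq)
  have := Int.isCoprime_iff_gcd_eq_one.mp h'
  rwa [Int.gcd_eq_natAbs, Int.natAbs_natCast] at this

/-- The class `A = ω(z₂, z₁) (mod |Δ|)` of `z₂/z₁`: `z₂ ≡ A z₁ (mod Δ)`. [cite: FriedlanderIwaniecAnnals1998, (6.6)] -/
private theorem dvd_sub_ratioClass_mul (h₁ : IsCoprime z₁ (star z₁)) (h₁₂ : IsCoprime z₁ z₂) :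
    ((fiDelta z₁ z₂).natAbs : GaussianInt) ∣
      z₂ - (ratioClass (fiDelta z₁ z₂).natAbs z₂ z₁ : GaussianInt) * z₁ := by
  apply dvd_sub_ratioClass_mul_of_dvd_im (coprime_norm_of_dvd h₁ h₁₂ dvd_rfl)
  rw [im_star_mul_swap, dvd_neg, fiDelta, Int.natCast_natAbs]
  exact abs_dvd_self _

/-- `(A, Δ) = 1` for the class `A` of `z₂/z₁`. [cite: FriedlanderIwaniecAnnals1998, (6.6)] -/
private theorem isCoprime_ratioClass_natAbs (h₁ : IsCoprime z₁ (star z₁)) (h₂ : IsCoprime z₂ (star z₂))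
    (h₁₂ : IsCoprime z₁ z₂) :
    IsCoprime (ratioClass (fiDelta z₁ z₂).natAbs z₂ z₁) ((fiDelta z₁ z₂).natAbs : ℤ) := by
  have hq2 : Nat.Coprime z₂.norm.natAbs (fiDelta z₁ z₂).natAbs := by
    have := coprime_norm_of_dvd (z₁ := z₂) (z₂ := z₁) h₂ h₁₂.symm dvd_rfl
    rwa [fiDelta, im_star_mul_swap, Int.natAbs_neg] at this
  apply isCoprime_ratioClass hq2 (coprime_norm_of_dvd h₁ h₁₂ dvd_rfl)
  rw [im_star_mul_swap, dvd_neg, fiDelta, Int.natCast_natAbs]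
  exact abs_dvd_self _

/-- **`(A/Δ') = (s₁/|r₁|)(s₂/|r₂|)`** — Lemma 17.1 ((17.5)) for the rational class `A ≡ z₂/z₁ (mod Δ)`
(the tree's Lemma 17.1 is stated at the representative `|z₁|² Re(z̄₁z₂)`; `A ≡ |z₁|² Re(z̄₁z₂) · v²`
with `v |z₁|² ≡ 1 (mod Δ)`). [cite: FriedlanderIwaniecAnnals1998, Lemma 17.1, (17.5)] -/
theorem jacobiSym_ratioClass_natAbs_ordCompl (hr₁ : Odd z₁.re) (hr₂ : Odd z₂.re)
    (h₁ : IsCoprime z₁ (star z₁)) (h₂ : IsCoprime z₂ (star z₂)) (h₁₂ : IsCoprime z₁ z₂)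
    (h8 : 8 ∣ z₁.re - z₂.re) (hpos : 0 < z₁.re * z₂.re) (hΔ0 : fiDelta z₁ z₂ ≠ 0) :
    J(ratioClass (fiDelta z₁ z₂).natAbs z₂ z₁ | ordCompl[2] (fiDelta z₁ z₂).natAbs) =
      J(z₁.im | z₁.re.natAbs) * J(z₂.im | z₂.re.natAbs) := by
  set n := (fiDelta z₁ z₂).natAbs with hn
  set n' := ordCompl[2] n with hn'
  have hL : J(z₁.norm * (star z₁ * z₂).re | n') = J(z₁.im | z₁.re.natAbs) * J(z₂.im | z₂.re.natAbs) :=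
    jacobiSym_norm_mul_re_star_mul_of_isCoprime hr₁ hr₂ h₁ h₂ h₁₂ h8 hpos hΔ0
  rw [← hL]
  have hcopN : Nat.Coprime z₁.norm.natAbs n := coprime_norm_of_dvd h₁ h₁₂ dvd_rfl
  obtain ⟨c, hc⟩ := dvd_normInv_mul_norm_sub_one hcopN
  set v := normInv n z₁ with hv
  have hA : ratioClass n z₂ z₁ = (star z₁ * z₂).re * v := by
    rw [ratioClass, re_mul_star_comm]
  have hn'n : ((n' : ℕ) : ℤ) ∣ (n : ℤ) := Int.natCast_dvd_natCast.mpr (Nat.ordCompl_dvd n 2)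
  -- `J(v N | n') = 1` and `J(v | n')² = 1`
  have hv1 : J(v * z₁.norm | n') = 1 := by
    rw [jacobiSym.mod_left' (a₂ := 1) ?_, jacobiSym.one_left]
    exact (Int.modEq_iff_dvd.mpr (hn'n.trans ⟨c, hc⟩)).symm
  have hvcop : IsCoprime v (n : ℤ) := ⟨z₁.norm, -c, by linear_combination hc⟩
  have hvsq : J(v | n') ^ 2 = 1 :=
    jacobiSym.sq_one (Int.isCoprime_iff_gcd_eq_one.mp (hvcop.of_isCoprime_of_dvd_right hn'n))
  calc J(ratioClass n z₂ z₁ | n')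
      = J((star z₁ * z₂).re * v | n') * J(v * z₁.norm | n') := by rw [hA, hv1, mul_one]
    _ = J((star z₁ * z₂).re * v * (v * z₁.norm) | n') := (jacobiSym.mul_left _ _ _).symm
    _ = J(z₁.norm * (star z₁ * z₂).re * v ^ 2 | n') := by congr 1; ring
    _ = J(z₁.norm * (star z₁ * z₂).re | n') * J(v | n') ^ 2 := by
        rw [jacobiSym.mul_left, jacobiSym.pow_left]
    _ = J(z₁.norm * (star z₁ * z₂).re | n') := by rw [hvsq, mul_one]

/-- **The symbol after the flip**: for `4ce ∣ Δ`,
`χ_{|Δ|/4e}(z₂/z₁) = ((z₂/z₁)/(|Δ| e)) = (s₁/|r₁|)(s₂/|r₂|) · (ω/e')` with `ω` the rational class of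
(16.3)/(17.9) modulo `4ce` ("because `((z₂/z₁)/(|Δ|/4d)) = ((z₂/z₁)/(|Δ|d))`", then (17.5) and
(17.8): the factor `(s₁/|r₁|)(s₂/|r₂|)` is absorbed into `β'`). [cite: FriedlanderIwaniecAnnals1998, §17 (17.1), (17.5), (17.8), (17.9)] -/
theorem fiChi_natAbs_div (hr₁ : Odd z₁.re) (hr₂ : Odd z₂.re)
    (h₁ : IsCoprime z₁ (star z₁)) (h₂ : IsCoprime z₂ (star z₂)) (h₁₂ : IsCoprime z₁ z₂)
    (h8 : 8 ∣ z₁.re - z₂.re) (hpos : 0 < z₁.re * z₂.re) (hΔ0 : fiDelta z₁ z₂ ≠ 0)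
    {c e : ℕ} (hc : 0 < c) (hce : 4 * (c * e) ∣ (fiDelta z₁ z₂).natAbs) :
    fiChi ((fiDelta z₁ z₂).natAbs / (4 * e)) z₁ z₂ =
      J(z₁.im | z₁.re.natAbs) * J(z₂.im | z₂.re.natAbs) *
        J(ratioClass (4 * (c * e)) z₁ z₂ | ordCompl[2] e) := by
  set n := (fiDelta z₁ z₂).natAbs with hn
  have hn0 : n ≠ 0 := Int.natAbs_ne_zero.mpr hΔ0
  have he4 : 4 * e ∣ n := (mul_dvd_mul_left 4 (dvd_mul_left e c)).trans hce
  set m := n / (4 * e) with hm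
  have hnm : 4 * e * m = n := Nat.mul_div_cancel' he4
  have he0 : 0 < e := Nat.pos_of_ne_zero fun h => hn0 (by rw [← hnm, h]; ring)
  have hm0 : 0 < m := Nat.pos_of_ne_zero fun h => hn0 (by rw [← hnm, h]; ring)
  set q := 4 * (c * e) with hq
  have hqn : q ∣ n := hce
  have hq0 : 0 < q := by positivity
  -- the odd parts
  set n' := ordCompl[2] n with hn'
  set m' := ordCompl[2] m with hm'
  set e' := ordCompl[2] e with he'
  have hn'eq : n' = e' * m' := by
    rw [hn', ← hnm, Nat.ordCompl_mul, Nat.ordCompl_mul, show (4 : ℕ) = 2 ^ 2 by norm_num,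
      Nat.ordCompl_self_pow Nat.prime_two, one_mul]
  have he'0 : e' ≠ 0 := (Nat.ordCompl_pos 2 he0.ne').ne'
  have hm'0 : m' ≠ 0 := (Nat.ordCompl_pos 2 hm0.ne').ne'
  have he'n : ((e' : ℕ) : ℤ) ∣ (n : ℤ) :=
    Int.natCast_dvd_natCast.mpr ((Dvd.intro m' hn'eq.symm).trans (Nat.ordCompl_dvd n 2))
  have hm'm : (m' : ℕ) ∣ 4 * m := (Nat.ordCompl_dvd m 2).trans (dvd_mul_left m 4)
  have he'q : (e' : ℕ) ∣ q := (Nat.ordCompl_dvd e 2).trans (by rw [hq]; exact (dvd_mul_left e c).trans (dvd_mul_left _ 4))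
  -- the classes: `A ≡ z₂/z₁ (mod n)`, `ω₀ ≡ z₂/z₁ (mod 4m)`, `ω ≡ z₁/z₂ (mod q)`
  set A := ratioClass n z₂ z₁ with hA
  have hAdvd : (n : GaussianInt) ∣ z₂ - (A : GaussianInt) * z₁ := dvd_sub_ratioClass_mul h₁ h₁₂
  have hAcop : IsCoprime A (n : ℤ) := isCoprime_ratioClass_natAbs h₁ h₂ h₁₂
  -- (a) `fiChi m = J(ω₀ | m') = J(A | m')`
  have h4m : 4 * m ∣ n := ⟨e, by rw [← hnm]; ring⟩
  have ha : fiChi m z₁ z₂ = J(A | m') := by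
    rw [fiChi]
    apply jacobiSym.mod_left'
    have hu := dvd_sub_ratioClass_of_dvd_sub (q := 4 * m) (coprime_norm_of_dvd h₁ h₁₂ h4m)
      ((Nat.cast_dvd_cast (α := GaussianInt) h4m).trans hAdvd)   -- hmm cast lemma name
    -- hu : (4m : ℤ) ∣ A - ratioClass (4m) z₂ z₁
    have hu' : ((m' : ℕ) : ℤ) ∣ A - ratioClass (4 * m) z₂ z₁ :=
      (Int.natCast_dvd_natCast.mpr hm'm).trans hu
    exact Int.modEq_iff_dvd.mpr hu'
  -- (b) `J(A | n') = J(A | e') J(A | m')`, `J(A | e')² = 1`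
  have hb : J(A | n') = J(A | e') * J(A | m') := by
    rw [hn'eq]; exact jacobiSym.mul_right' A he'0 hm'0
  have hAe : J(A | e') ^ 2 = 1 :=
    jacobiSym.sq_one (Int.isCoprime_iff_gcd_eq_one.mp (hAcop.of_isCoprime_of_dvd_right he'n))
  have hAm : J(A | m') = J(A | n') * J(A | e') := by
    rw [hb, mul_comm (J(A | e')), mul_assoc, ← sq, hAe, mul_one]
  -- (c) `J(A | n') = (s₁/|r₁|)(s₂/|r₂|)` (Lemma 17.1)
  have hcσ : J(A | n') = J(z₁.im | z₁.re.natAbs) * J(z₂.im | z₂.re.natAbs) :=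
    jacobiSym_ratioClass_natAbs_ordCompl hr₁ hr₂ h₁ h₂ h₁₂ h8 hpos hΔ0
  -- (d) `J(A | e') = J(ω | e')`, `ω A ≡ 1 (mod q)`
  set ω := ratioClass q z₁ z₂ with hω
  have hcop2q : Nat.Coprime z₂.norm.natAbs q := by
    have hq' : q ∣ (fiDelta z₂ z₁).natAbs := by
      have e1 : (fiDelta z₂ z₁).natAbs = n := by
        rw [hn, fiDelta, fiDelta, im_star_mul_swap, Int.natAbs_neg]
      exact e1 ▸ hqn
    exact coprime_norm_of_dvd (q := q) (z₁ := z₂) (z₂ := z₁) h₂ h₁₂.symm hq'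
  have hcop1q : Nat.Coprime z₁.norm.natAbs q := coprime_norm_of_dvd h₁ h₁₂ hqn
  have hnΔ : ((n : ℕ) : ℤ) ∣ (star z₁ * z₂).im := Int.natAbs_dvd.mpr dvd_rfl
  have hωdvd : (q : GaussianInt) ∣ z₁ - (ω : GaussianInt) * z₂ :=
    dvd_sub_ratioClass_mul_of_dvd_im hcop2q ((Int.natCast_dvd_natCast.mpr hqn).trans hnΔ)
  have hAdvdq : (q : GaussianInt) ∣ z₂ - (A : GaussianInt) * z₁ :=
    (Nat.cast_dvd_cast (α := GaussianInt) hqn).trans hAdvd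
  have hωA : (q : ℤ) ∣ 1 - ω * A := by
    -- `q ∣ (1 - ωA) z₁` in `ℤ[i]`, multiply by `z̄₁`
    have h1 : (q : GaussianInt) ∣ ((1 - ω * A : ℤ) : GaussianInt) * z₁ := by
      have e1 : ((1 - ω * A : ℤ) : GaussianInt) * z₁ =
          (z₁ - (ω : GaussianInt) * z₂) + (ω : GaussianInt) * (z₂ - (A : GaussianInt) * z₁) := by
        push_cast; ring
      rw [e1]
      exact dvd_add hωdvd (Dvd.dvd.mul_left hAdvdq _)
    have h2 : (q : GaussianInt) ∣ (((1 - ω * A) * z₁.norm : ℤ) : GaussianInt) := by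
      have e2 : (((1 - ω * A) * z₁.norm : ℤ) : GaussianInt) = ((1 - ω * A : ℤ) : GaussianInt) * z₁ * star z₁ := by
        push_cast; rw [mul_assoc, ← Zsqrtd.norm_eq_mul_conj]
      rw [e2]
      exact Dvd.dvd.mul_right h1 _
    have h3 : (q : ℤ) ∣ (1 - ω * A) * z₁.norm := by
      have h2' : ((q : ℤ) : GaussianInt) ∣ (((1 - ω * A) * z₁.norm : ℤ) : GaussianInt) := by
        rwa [Int.cast_natCast]
      exact (Zsqrtd.intCast_dvd_intCast (d := -1) (q : ℤ) _).mp h2'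
    have hcopq : IsCoprime (q : ℤ) z₁.norm := by
      rw [Int.isCoprime_iff_gcd_eq_one, Int.gcd_comm, Int.gcd_eq_natAbs, Int.natAbs_natCast]
      exact hcop1q
    exact hcopq.dvd_of_dvd_mul_right h3
  have hωA1 : J(ω * A | e') = 1 := by
    rw [jacobiSym.mod_left' (a₂ := 1) ?_, jacobiSym.one_left]
    exact Int.modEq_iff_dvd.mpr ((Int.natCast_dvd_natCast.mpr he'q).trans hωA)
  have hd : J(A | e') = J(ω | e') := by
    have h := hωA1
    rw [jacobiSym.mul_left] at h
    calc J(A | e') = J(ω | e') * J(A | e') * J(A | e') := by rw [h, one_mul]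
      _ = J(ω | e') * J(A | e') ^ 2 := by ring
      _ = J(ω | e') := by rw [hAe, mul_one]
  -- assemble
  rw [ha, hAm, hcσ, hd]

end Symbol

/-- **`Δ(z₁, z₂) ≠ 0` for admissible pairs**: if `(z₁, z̄₁) = (z₁, z₂) = 1` and `z₁` is not a unit
then `Im(z̄₁ z₂) ≠ 0` (were `z̄₁z₂ = k` rational, `z₁ ∣ z₁ z̄₂ = k` and `(z₁, k) = 1`). This is the
remark "Note that `1 ≤ d ≤ N` because `1 ≤ |Δ| ≤ N`" after (10.13). [cite: FriedlanderIwaniecAnnals1998, §10 after (10.13)] -/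
theorem fiDelta_ne_zero_of_isCoprime {z₁ z₂ : GaussianInt} (h₁ : IsCoprime z₁ (star z₁))
    (h₁₂ : IsCoprime z₁ z₂) (hu : ¬ IsUnit z₁) : fiDelta z₁ z₂ ≠ 0 := by
  intro hΔ
  apply hu
  set k : ℤ := (star z₁ * z₂).re with hk
  have hprod : star z₁ * z₂ = (k : GaussianInt) := by
    ext
    · simp [hk]
    · rw [fiDelta] at hΔ; simp [hΔ]
  have hdvd : z₁ ∣ (k : GaussianInt) := by
    have : (k : GaussianInt) = star z₂ * z₁ := by
      have h := congrArg star hprod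
      rw [star_mul, star_star] at h
      simpa using h.symm
    exact Dvd.intro_left (star z₂) this.symm
  have hcop : IsCoprime z₁ (k : GaussianInt) := hprod ▸ h₁.mul_right h₁₂
  exact hcop.isUnit_of_dvd' dvd_rfl hdvd

/-! ### The inner sum of `W(β)` for one pair `(z₁, z₂)`: flip, Möbius, Lemma 17.1 -/

section Inner

variable {z₁ z₂ : GaussianInt}

/-- Reindexing the moduli: for `0 < |Δ| ≤ 4D`,
`Σ_{4e∣Δ} Σ_{c ∣ |Δ|/4e} F(e, c) = Σ_{c ≤ D} Σ_{e ≤ D} [4ce ∣ Δ] F(e, c)`. [folklore] -/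
private theorem sum_fiModuli_sum_divisors_eq (hΔ0 : fiDelta z₁ z₂ ≠ 0) {D : ℕ}
    (hD : (fiDelta z₁ z₂).natAbs ≤ 4 * D) (F : ℕ → ℕ → ℝ) :
    ∑ e ∈ fiModuli z₁ z₂, ∑ c ∈ ((fiDelta z₁ z₂).natAbs / (4 * e)).divisors, F e c =
      ∑ c ∈ Icc 1 D, ∑ e ∈ Icc 1 D,
        if (((4 * (c * e) : ℕ) : ℤ)) ∣ fiDelta z₁ z₂ then F e c else 0 := by
  set n := (fiDelta z₁ z₂).natAbs with hn
  have hn0 : n ≠ 0 := Int.natAbs_ne_zero.mpr hΔ0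
  have hdvd : ∀ c e : ℕ, (((4 * (c * e) : ℕ) : ℤ)) ∣ fiDelta z₁ z₂ ↔ 4 * (c * e) ∣ n := fun c e => by
    rw [hn, ← Int.natCast_dvd]
  rw [sum_comm]
  -- extend the `e`-sum to `Icc 1 D`
  have hsub : fiModuli z₁ z₂ ⊆ Icc 1 D := by
    intro e he
    obtain ⟨-, ⟨k, hk⟩⟩ := mem_fiModuli_iff.mp he
    rw [← hn] at hk
    rw [mem_Icc]
    constructor
    · exact Nat.pos_of_ne_zero fun h => hn0 (by rw [hk, h]; ring)
    · have hk0 : 0 < k := Nat.pos_of_ne_zero fun h => hn0 (by rw [hk, h]; ring)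
      nlinarith
  rw [← sum_subset hsub (fun e he hne => ?_)]
  · refine sum_congr rfl fun e he => ?_
    obtain ⟨-, he4⟩ := mem_fiModuli_iff.mp he
    rw [← hn] at he4
    have he0 : 0 < e := (mem_Icc.mp (hsub he)).1
    -- the `c`-sum: divisors of `n/(4e)` inside `Icc 1 D`
    have hsubc : (n / (4 * e)).divisors ⊆ Icc 1 D := by
      intro c hc
      rw [mem_Icc]
      refine ⟨Nat.pos_of_mem_divisors hc, (Nat.divisor_le hc).trans ?_⟩
      calc n / (4 * e) ≤ n / 4 := Nat.div_le_div_left (Nat.le_mul_of_pos_right 4 he0) (by norm_num)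
        _ ≤ D := Nat.div_le_of_le_mul hD
    rw [← sum_subset hsubc (fun c hc hnc => ?_)]
    · refine sum_congr rfl fun c hc => ?_
      rw [if_pos]
      rw [hdvd, show 4 * (c * e) = 4 * e * c by ring]
      exact (Nat.dvd_div_iff_mul_dvd he4).mp (Nat.dvd_of_mem_divisors hc)
    · rw [if_neg]
      rw [hdvd, show 4 * (c * e) = 4 * e * c by ring, ← Nat.dvd_div_iff_mul_dvd he4]
      intro h
      exact hnc (Nat.mem_divisors.mpr ⟨h, fun h0 => hn0 (by
        rw [← Nat.mul_div_cancel' he4, h0, mul_zero])⟩)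
  · -- `e ∉ fiModuli`: every indicator vanishes
    refine sum_eq_zero fun c _ => ?_
    rw [if_neg]
    rw [hdvd]
    intro h
    apply hne
    rw [mem_fiModuli_iff, ← hn]
    exact ⟨hn0, (Dvd.intro c (by ring) : 4 * e ∣ 4 * (c * e)).trans h⟩

/-- **The inner sum of `W(β)` for one admissible pair** (`(z₁,z̄₁) = (z₂,z̄₂) = (z₁,z₂) = 1`,
`z₁ ≡ z₂ (mod 8)` on the real parts, same half-plane, `0 < |Δ| ≤ 4D`):
`Σ_{4d∣Δ} f*(|Δ|/d) φ(d)/d χ_d(z₂/z₁) log(2|z₁z₂|/|Δ|)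
  = Σ_{c ≤ D} Σ_{e ≤ D} [4ce ∣ Δ] f*(4e) μ(c)/c · (s₁/|r₁|)(s₂/|r₂|) (ω_{4ce}/e') · log(2|z₁z₂|/|Δ|)`
— the flip, "`(4d/|Δ|)φ(|Δ|/4d) = Σ_{4bd∣Δ} μ(b)/b`", (17.5) and (17.8)–(17.9) for one pair.
[cite: FriedlanderIwaniecAnnals1998, §17 (17.1), (17.5), (17.8), (17.9)] -/
theorem sum_fiModuli_cutW_kernel_eq (hr₁ : Odd z₁.re) (hr₂ : Odd z₂.re)
    (h₁ : IsCoprime z₁ (star z₁)) (h₂ : IsCoprime z₂ (star z₂)) (h₁₂ : IsCoprime z₁ z₂)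
    (h8 : 8 ∣ z₁.re - z₂.re) (hpos : 0 < z₁.re * z₂.re) (hΔ0 : fiDelta z₁ z₂ ≠ 0)
    {D : ℕ} (hD : (fiDelta z₁ z₂).natAbs ≤ 4 * D) (X : ℝ) :
    ∑ d ∈ fiModuli z₁ z₂, fiCutW X d (|(fiDelta z₁ z₂ : ℝ)| / d) * fiTKernel d z₁ z₂ =
      ∑ c ∈ Icc 1 D, ∑ e ∈ Icc 1 D,
        if (((4 * (c * e) : ℕ) : ℤ)) ∣ fiDelta z₁ z₂ then
          fiTenFstar X (4 * e) * ((μ c : ℝ) / c) *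
            ((J(z₁.im | z₁.re.natAbs) * J(z₂.im | z₂.re.natAbs) *
              J(ratioClass (4 * (c * e)) z₁ z₂ | ordCompl[2] e) : ℤ) : ℝ) *
            Real.log (2 * fiAbsProd z₁ z₂ / |(fiDelta z₁ z₂ : ℝ)|)
        else 0 := by
  have hn0 : (fiDelta z₁ z₂).natAbs ≠ 0 := Int.natAbs_ne_zero.mpr hΔ0
  have hnR : ((fiDelta z₁ z₂).natAbs : ℝ) = |(fiDelta z₁ z₂ : ℝ)| := by
    rw [Nat.cast_natAbs, Int.cast_abs]
  rw [sum_fiModuli_flip, ← sum_fiModuli_sum_divisors_eq hΔ0 hD]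
  refine sum_congr rfl fun e he => ?_
  obtain ⟨-, he4⟩ := mem_fiModuli_iff.mp he
  have hnm : 4 * e * ((fiDelta z₁ z₂).natAbs / (4 * e)) = (fiDelta z₁ z₂).natAbs :=
    Nat.mul_div_cancel' he4
  have he0 : 0 < e := Nat.pos_of_ne_zero fun h => hn0 (by rw [← hnm, h]; ring)
  have hm0 : 0 < (fiDelta z₁ z₂).natAbs / (4 * e) :=
    Nat.pos_of_ne_zero fun h => hn0 (by rw [← hnm, h]; ring)
  -- (i) `|Δ| / (|Δ|/4e) = 4e`
  have hi : |(fiDelta z₁ z₂ : ℝ)| / (((fiDelta z₁ z₂).natAbs / (4 * e) : ℕ) : ℝ) = 4 * e := by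
    rw [← hnR]
    have h : ((fiDelta z₁ z₂).natAbs : ℝ) = 4 * e * (((fiDelta z₁ z₂).natAbs / (4 * e) : ℕ) : ℝ) := by
      exact_mod_cast hnm.symm
    have hm0' : (0 : ℝ) < (((fiDelta z₁ z₂).natAbs / (4 * e) : ℕ) : ℝ) := by exact_mod_cast hm0
    rw [h]
    field_simp
  simp only [fiCutW, fiTKernel]
  rw [hi, totient_div_eq_sum_moebius_div hm0, sum_mul, sum_mul, mul_sum]
  refine sum_congr rfl fun c hc => ?_
  have hce : 4 * (c * e) ∣ (fiDelta z₁ z₂).natAbs := by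
    rw [show 4 * (c * e) = 4 * e * c by ring]
    exact (Nat.dvd_div_iff_mul_dvd he4).mp (Nat.dvd_of_mem_divisors hc)
  rw [fiChi_natAbs_div hr₁ hr₂ h₁ h₂ h₁₂ h8 hpos hΔ0 (Nat.pos_of_mem_divisors hc) hce]
  push_cast
  ring

end Inner

/-! ### (17.9): `W(β)` over the moduli `4bd`, with `β'` and the rational classes -/

/-- **FI (17.1) + Lemma 17.1 + (17.9) for the tree's `W(β) = fiW`.** For a finite set `S` of Gaussian
integers with odd real parts all congruent modulo `8` and of one sign, `(z, z̄) = 1` on `S`,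
`Δ(z₁,z₂) ≠ 0` for coprime pairs and `|Δ| ≤ 4D` on `S × S`:
`W(β) = 2 Σ_{b ≤ D} μ(b)/b Σ_{d ≤ D} f*(4d) ΣΣ_{(z₁,z₂)=1, Δ ≡ 0 (4bd)} (ω/d') β'_{z₁} β'_{z₂} log(2|z₁z₂|/|Δ|)`
with `β'_z = (s/|r|) β_z` (the real form of (17.8): the units `i^{(r-1)/2}` cancel in pairs since
`r₁ ≡ r₂ (mod 8)`) and `ω = ratioClass (4bd) z₁ z₂` the rational class of `z₁/z₂ (mod 4bd)` ((16.3);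
the symbol of the inverse class `z₂/z₁` printed in (17.9) has the same value). The moduli are
written over the fixed ranges `b, d ≤ D` with the divisibility as an indicator, ready for the
detection (17.10) by `sum_sum_dvd_im_eq_sum_mulChar`.
[cite: FriedlanderIwaniecAnnals1998, §17 (17.1), (17.8), (17.9)] -/
theorem fiW_eq_sum_moebius_flip {S : Finset GaussianInt} {b : GaussianInt → ℝ} {X : ℝ} {D : ℕ}
    (hodd : ∀ z ∈ S, Odd z.re) (hconj : ∀ z ∈ S, IsCoprime z (star z))
    (h8 : ∀ z₁ ∈ S, ∀ z₂ ∈ S, 8 ∣ z₁.re - z₂.re) (hpos : ∀ z₁ ∈ S, ∀ z₂ ∈ S, 0 < z₁.re * z₂.re)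
    (hΔ : ∀ z₁ ∈ S, ∀ z₂ ∈ S, GaussCoprime z₁ z₂ → fiDelta z₁ z₂ ≠ 0)
    (hD : ∀ z₁ ∈ S, ∀ z₂ ∈ S, (fiDelta z₁ z₂).natAbs ≤ 4 * D) :
    fiW X S b = 2 * ∑ c ∈ Icc 1 D, ∑ e ∈ Icc 1 D, ((μ c : ℝ) / c) * fiTenFstar X (4 * e) *
      ∑ z₁ ∈ S, ∑ z₂ ∈ S, if GaussCoprime z₁ z₂ then
        (if (((4 * (c * e) : ℕ) : ℤ)) ∣ fiDelta z₁ z₂ then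
          (J(ratioClass (4 * (c * e)) z₁ z₂ | ordCompl[2] e) : ℝ) *
            ((b z₁ * J(z₁.im | z₁.re.natAbs)) * (b z₂ * J(z₂.im | z₂.re.natAbs))) *
            Real.log (2 * fiAbsProd z₁ z₂ / |(fiDelta z₁ z₂ : ℝ)|) else 0) else 0 := by
  -- one pair at a time
  have hpair : ∀ z₁ ∈ S, ∀ z₂ ∈ S,
      (if GaussCoprime z₁ z₂ then b z₁ * b z₂ *
          ∑ d ∈ fiModuli z₁ z₂, fiCutW X d (|(fiDelta z₁ z₂ : ℝ)| / d) * fiTKernel d z₁ z₂ else 0) =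
        ∑ c ∈ Icc 1 D, ∑ e ∈ Icc 1 D, ((μ c : ℝ) / c) * fiTenFstar X (4 * e) *
          (if GaussCoprime z₁ z₂ then
            (if (((4 * (c * e) : ℕ) : ℤ)) ∣ fiDelta z₁ z₂ then
              (J(ratioClass (4 * (c * e)) z₁ z₂ | ordCompl[2] e) : ℝ) *
                ((b z₁ * J(z₁.im | z₁.re.natAbs)) * (b z₂ * J(z₂.im | z₂.re.natAbs))) *
                Real.log (2 * fiAbsProd z₁ z₂ / |(fiDelta z₁ z₂ : ℝ)|) else 0) else 0) := by
    intro z₁ hz₁ z₂ hz₂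
    by_cases hcop : GaussCoprime z₁ z₂
    · simp only [if_pos hcop]
      rw [sum_fiModuli_cutW_kernel_eq (hodd z₁ hz₁) (hodd z₂ hz₂) (hconj z₁ hz₁) (hconj z₂ hz₂)
        ((gaussCoprime_iff z₁ z₂).mp hcop) (h8 z₁ hz₁ z₂ hz₂) (hpos z₁ hz₁ z₂ hz₂)
        (hΔ z₁ hz₁ z₂ hz₂ hcop) (hD z₁ hz₁ z₂ hz₂) X, mul_sum]
      refine sum_congr rfl fun c _ => ?_
      rw [mul_sum]
      refine sum_congr rfl fun e _ => ?_
      split_ifs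
      · push_cast; ring
      · ring
    · simp only [if_neg hcop, mul_zero, sum_const_zero]
  unfold fiW fiTwisted
  congr 1
  rw [sum_congr rfl fun z₁ hz₁ => sum_congr rfl fun z₂ hz₂ => hpair z₁ hz₁ z₂ hz₂]
  simp_rw [mul_sum]
  calc ∑ z₁ ∈ S, ∑ z₂ ∈ S, ∑ c ∈ Icc 1 D, ∑ e ∈ Icc 1 D, _
      = ∑ z₁ ∈ S, ∑ c ∈ Icc 1 D, ∑ z₂ ∈ S, ∑ e ∈ Icc 1 D, _ := sum_congr rfl fun _ _ => sum_comm
    _ = ∑ c ∈ Icc 1 D, ∑ z₁ ∈ S, ∑ z₂ ∈ S, ∑ e ∈ Icc 1 D, _ := sum_comm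
    _ = ∑ c ∈ Icc 1 D, ∑ z₁ ∈ S, ∑ e ∈ Icc 1 D, ∑ z₂ ∈ S, _ :=
        sum_congr rfl fun _ _ => sum_congr rfl fun _ _ => sum_comm
    _ = ∑ c ∈ Icc 1 D, ∑ e ∈ Icc 1 D, ∑ z₁ ∈ S, ∑ z₂ ∈ S, _ := sum_congr rfl fun _ _ => sum_comm

end Literature.NumberTheory.Sieve.FriedlanderIwaniecPrimes
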